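import Literature.Barriers.CriticalPhenomena.RigorousRGSmallParameterFlowToMassScale

/-!
# `RigorousRGSmallParameter` (Slade, Theorem 1.4.1): Corollary 7.2.5 — right-continuity of the
# critical initial value at `m² = 0`, with the renormalisation-group inputs explicit

Companion of `RigorousRGSmallParameterFlowToMassScale.lean` (Theorem 7.2.2, Lemma 7.2.1,
Corollary 7.2.4 in the same abstract setting: Banach spaces `𝒲_j` for `K_j`, the remainders
`r_μ, r_y`, the map `Ǩ` and the coefficients `β, β^:, ξ̃` as data subject to the hypotheses
`CriticalFlow.Hyp`). Source: G. Slade, *Critical exponents for long-range `O(n)` models below the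
upper critical dimension*, Commun. Math. Phys. **358** (2018) 343–436, arXiv:1611.06169v4, §7.2.4.

## The printed statement and proof

**Corollary 7.2.5.** "The limit `lim_{m²↓0} μ₀(m²)` exists and equals `μ₀(0)` (the critical
initial value for the case `m̃² = m² = 0`)." Proof: "Fix `y_0` with `|y_0| ≤ ω_0s̄`, fix a sequence
`m' ↓ 0`, and let `x'_0 = (μ₀(m'), y_0, 𝟙_∅)`. Since `μ₀(m')` remains in a bounded subset of `ℝ`, it
has a limit point `μ₀*`. It suffices to show that `μ₀* = μ₀(0)`, for any sequence `m'`. Let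
`x*_0 = (μ₀*, y_0, 𝟙_∅)`. We use `x*_0` as the initial condition for the flow equations
(7.13)–(7.15), and we solve those flow equations inductively, to produce `x*_j` … On the other
hand, with initial condition `x'_0` the fixed point solves the equations for `j ≤ j_{m'_-}`, with
`x'_j ∈ B₁(X_j)`. Given any fixed `j`, eventually `j < j_{m'_-}` as `m' ↓ 0`. By the continuity of
the RG map at `m² = 0` (recall Theorem 6.3.1), we know that `x'_j` converges to `x*_j`, which must
remain in the closed ball `B₁(X_j)`. This produces a sequence `x*_j` for all `j < ∞`, which is a
solution of the zero-mass flow equations for all `j`, and hence a fixed point of the zero-mass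
`T`. This fixed point is unique, and `x*_0 = (μ₀(0), y_0, 𝟙_∅)`. Therefore, `μ₀* = μ₀(0)`."

## What this file proves (everything; no named fact is introduced)

* `CriticalFlow.fwd` — the forward solution `x*_j` of the flow equations of Lemma 7.1.1 from an
  initial value `(μ, y_0, K_0)`; `fwd_fixedPoint` — its rescaling is a fixed point of the
  untruncated (`w ≡ 1`, zero-mass) map `T` (pure algebra); `rescale`, `μv_rescale` etc.
* `Slade2017_cor725` — **Corollary 7.2.5 with inputs explicit, sequential form**: along a
  sequence of data `d_n` (the masses `m'_n ↓ 0`) satisfying `Hyp` with the same constants, whose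
  truncation weights are eventually `1` at every fixed scale ("eventually `j < j_{m'_-}`"), and
  which converge pointwise to zero-mass data `d₀` (coefficients, and the maps `r_μ, r_y, Ǩ` at every
  point of the domain: "the continuity of the RG map at `m² = 0`", Theorem 6.3.1, and of
  `β, β^:, ξ̃`, Lemma 5.2.1), the `μ`-components at scale `0` of the fixed points `x^c(d_n) ∈ B₁`
  converge to that of the unique fixed point of the zero-mass `T` in `B₁`. The proof is the
  printed one: a limit point `μ*` by compactness of `[-σs̄², σs̄²]`; by induction on `j`,
  `x'_j → x*_j` along the subsequence (Lipschitz bounds of `Hyp` in the arguments plus pointwise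
  convergence in `n` give the joint continuity used); the limits stay in the closed domain; the
  rescaled `x*` is a fixed point of the zero-mass `T` in `B₁`, hence equals `x^c(d₀)` by
  uniqueness; and a sequence all of whose subsequences have a sub-subsequence converging to the
  same point converges (`Filter.tendsto_of_subseq_tendsto`).
* `Slade2017_cor725'` — the same with the fixed points supplied by `CriticalFlow.exists_fixedPoint`.

Not treated: Lemma 7.2.7, Theorem 7.3.1 (the flow beyond the mass scale).
-/

noncomputable section

namespace Literature.Barriers.CriticalPhenomena

open Set Metric Filter Function
open scoped Topology NNReal ENNReal

namespace LongRangePhi4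

namespace CriticalFlow

variable {W : ℕ → Type*} [∀ j, NormedAddCommGroup (W j)] [∀ j, NormedSpace ℝ (W j)]

section Fwd

variable (c : Consts) (d : Data W) (y₀ : ℝ) (K₀ : W 0)

/-- The forward solution `x*_j = (μ_j, y_j, K_j)` (physical coordinates) of the flow equations
(7.13)–(7.15) from the initial condition `(μ, y_0, K_0)`: "we solve those flow equations
inductively, to produce `x*_j`". [cite: Slade2017, Corollary 7.2.5 (proof)] -/
def fwd (μ : ℝ) : (j : ℕ) → ℝ × ℝ × W j
  | 0 => (μ, y₀, K₀)
  | j + 1 =>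
    (c.Lα * (fwd μ j).1 + ρμ c d j (fwd μ j).1 (fwd μ j).2.1
        + d.rμ j (fwd μ j).1 (fwd μ j).2.1 (fwd μ j).2.2,
      Ymap c d j (fwd μ j).2.1 + d.ry j (fwd μ j).1 (fwd μ j).2.1 (fwd μ j).2.2,
      d.Kc j (fwd μ j).1 (fwd μ j).2.1 (fwd μ j).2.2)

/-- The rescaling of a physical sequence `(μ_j, y_j, K_j)_j` into the coordinates of `X`
(`μ_j/𝔴_μ`, `y_j/𝔴_{y,j}`, `K_j/𝔴_K`; the `y, K` slots at `j = 0` are the dummies `0`).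
[cite: Slade2017, (7.17)–(7.18)] -/
def rescale (t : (j : ℕ) → ℝ × ℝ × W j) : (j : ℕ) → ℝ × ℝ × W j
  | 0 => ((t 0).1 / c.wμ, 0, 0)
  | j + 1 => ((t (j + 1)).1 / c.wμ, (t (j + 1)).2.1 / c.wy (j + 1), c.wK⁻¹ • (t (j + 1)).2.2)

variable {c d y₀ K₀}

omit [∀ j, NormedAddCommGroup (W j)] [∀ j, NormedSpace ℝ (W j)] in
/-- `fwd` at scale `0`. [cite: Slade2017, Corollary 7.2.5 (proof)] -/
theorem fwd_zero (μ : ℝ) : fwd c d y₀ K₀ μ 0 = (μ, y₀, K₀) := rfl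

omit [∀ j, NormedAddCommGroup (W j)] [∀ j, NormedSpace ℝ (W j)] in
/-- `fwd` at scale `j+1`: the flow equations (7.13)–(7.15). [cite: Slade2017, Lemma 7.1.1] -/
theorem fwd_succ (μ : ℝ) (j : ℕ) : fwd c d y₀ K₀ μ (j + 1) =
    (c.Lα * (fwd c d y₀ K₀ μ j).1 + ρμ c d j (fwd c d y₀ K₀ μ j).1 (fwd c d y₀ K₀ μ j).2.1
        + d.rμ j (fwd c d y₀ K₀ μ j).1 (fwd c d y₀ K₀ μ j).2.1 (fwd c d y₀ K₀ μ j).2.2,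
      Ymap c d j (fwd c d y₀ K₀ μ j).2.1
        + d.ry j (fwd c d y₀ K₀ μ j).1 (fwd c d y₀ K₀ μ j).2.1 (fwd c d y₀ K₀ μ j).2.2,
      d.Kc j (fwd c d y₀ K₀ μ j).1 (fwd c d y₀ K₀ μ j).2.1 (fwd c d y₀ K₀ μ j).2.2) := rfl

variable (hwμ : c.wμ ≠ 0) (hwy : ∀ j, c.wy j ≠ 0) (hwK : c.wK ≠ 0)
include hwμ in
/-- Physical `μ` of the rescaled sequence. [cite: Slade2017, (7.17)–(7.18)] -/
theorem μv_rescale (t : (j : ℕ) → ℝ × ℝ × W j) (j : ℕ) : μv c (rescale c t) j = (t j).1 := by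
  rcases j with _ | j <;> simp only [μv, rescale] <;> field_simp

include hwy in
/-- Physical `y` of the rescaled sequence (`j ≥ 1`; at `j = 0` it is `y_0`).
[cite: Slade2017, (7.17)–(7.18)] -/
theorem yv_rescale_succ (t : (j : ℕ) → ℝ × ℝ × W j) (j : ℕ) :
    yv c y₀ (rescale c t) (j + 1) = (t (j + 1)).2.1 := by
  rw [yv_succ]; simp only [rescale]; field_simp [hwy (j + 1)]

include hwK in
/-- Physical `K` of the rescaled sequence (`j ≥ 1`; at `j = 0` it is `K_0`).
[cite: Slade2017, (7.17)–(7.18)] -/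
theorem Kv_rescale_succ (t : (j : ℕ) → ℝ × ℝ × W j) (j : ℕ) :
    Kv c K₀ (rescale c t) (j + 1) = (t (j + 1)).2.2 := by
  rw [Kv_succ]; simp only [rescale]; rw [smul_smul, mul_inv_cancel₀ hwK, one_smul]

include hwμ hwy hwK in
/-- **The forward solution is a fixed point of the untruncated map `T`** ("a solution of the
zero-mass flow equations for all `j`, and hence a fixed point of the zero-mass `T`"): if all
weights are `1`, the rescaling of `fwd μ` satisfies `x = Tx` (pure algebra: the `μ`-row of `T` is
the `μ`-equation solved backwards). [cite: Slade2017, Corollary 7.2.5 (proof)] -/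
theorem fwd_fixedPoint (hLα : c.Lα ≠ 0) (hw : ∀ j, d.w j = 1) (μ : ℝ) :
    rescale c (fwd c d y₀ K₀ μ) = Trow c d y₀ K₀ (rescale c (fwd c d y₀ K₀ μ)) := by
  set t := fwd c d y₀ K₀ μ with ht
  have hμ : ∀ j, μv c (rescale c t) j = (t j).1 := μv_rescale hwμ _
  have hy : ∀ j, yv c y₀ (rescale c t) j = (t j).2.1 := by
    intro j; rcases j with _ | j
    · rw [yv_zero]; rfl
    · exact yv_rescale_succ hwy _ j
  have hK : ∀ j, Kv c K₀ (rescale c t) j = (t j).2.2 := by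
    intro j; rcases j with _ | j
    · rfl
    · exact Kv_rescale_succ hwK _ j
  funext j
  refine Prod.ext ?_ (Prod.ext ?_ ?_)
  · -- `μ`-row: `μ_j/𝔴_μ = L^{-α}(μ_{j+1} - ρ_{μ,j} - r_{μ,j})/𝔴_μ`
    have lhs : (rescale c t j).1 = (t j).1 / c.wμ := by rcases j with _ | j <;> rfl
    rw [lhs]; simp only [Trow]; rw [hw, one_mul, rowμ, hμ, hμ, hy, hK]
    have e : (t (j + 1)).1 = c.Lα * (t j).1 + ρμ c d j (t j).1 (t j).2.1
        + d.rμ j (t j).1 (t j).2.1 (t j).2.2 := by rw [ht]; rfl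
    rw [e]
    congr 1
    field_simp
    ring
  · rcases j with _ | j
    · simp only [Trow, rowy_zero, mul_zero, zero_div]; rfl
    · have lhs : (rescale c t (j + 1)).2.1 = (t (j + 1)).2.1 / c.wy (j + 1) := rfl
      rw [lhs]; simp only [Trow]; rw [hw, one_mul, rowy_succ, hμ, hy, hK]
      have e : (t (j + 1)).2.1 = Ymap c d j (t j).2.1 + d.ry j (t j).1 (t j).2.1 (t j).2.2 := by
        rw [ht]; rfl
      rw [e]
  · rcases j with _ | j
    · simp only [Trow, rowK_zero, smul_zero]; rfl
    · have lhs : (rescale c t (j + 1)).2.2 = c.wK⁻¹ • (t (j + 1)).2.2 := rfl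
      rw [lhs]; simp only [Trow]; rw [hw, one_div, rowK_succ, hμ, hy, hK]
      have e : (t (j + 1)).2.2 = d.Kc j (t j).1 (t j).2.1 (t j).2.2 := by rw [ht]; rfl
      rw [e]

end Fwd

/-! ### Corollary 7.2.5 -/

section Cor725

variable {c : Consts} {y₀ : ℝ} {K₀ : W 0} {d : ℕ → Data W} {d₀ : Data W}

omit [∀ j, NormedAddCommGroup (W j)] [∀ j, NormedSpace ℝ (W j)] in
/-- Convergence of the `ρ_{μ,j}` term along convergent coefficients and arguments.
[cite: Slade2017, (7.11), Lemma 5.2.1 (continuity in m²)] -/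
theorem tendsto_ρμ {l : Filter ℕ} {e : ℕ → ℕ} {j : ℕ} {m y : ℕ → ℝ} {m₀ y₀' : ℝ}
    (hβ : Tendsto (fun k => (d (e k)).β j) l (𝓝 (d₀.β j)))
    (hξ : Tendsto (fun k => (d (e k)).ξ j) l (𝓝 (d₀.ξ j)))
    (hm : Tendsto m l (𝓝 m₀)) (hy : Tendsto y l (𝓝 y₀')) :
    Tendsto (fun k => ρμ c (d (e k)) j (m k) (y k)) l (𝓝 (ρμ c d₀ j m₀ y₀')) := by
  simp only [ρμ]
  exact tendsto_const_nhds.mul ((((tendsto_const_nhds.mul hβ).mul hm).mul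
    (tendsto_const_nhds.sub hy)).add (hξ.mul ((tendsto_const_nhds.sub hy).pow 2)))

omit [∀ j, NormedAddCommGroup (W j)] [∀ j, NormedSpace ℝ (W j)] in
/-- Convergence of `Ymap_j` along convergent `β^:_j` and argument.
[cite: Slade2017, (7.14), Lemma 5.2.1 (continuity in m²)] -/
theorem tendsto_Ymap {l : Filter ℕ} {e : ℕ → ℕ} {j : ℕ} {y : ℕ → ℝ} {y₀' : ℝ}
    (hβW : Tendsto (fun k => (d (e k)).βW j) l (𝓝 (d₀.βW j))) (hy : Tendsto y l (𝓝 y₀')) :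
    Tendsto (fun k => Ymap c (d (e k)) j (y k)) l (𝓝 (Ymap c d₀ j y₀')) := by
  simp only [Ymap]
  exact ((tendsto_const_nhds.mul hy).add ((tendsto_const_nhds.mul (hy.pow 2)))).add
    (((hβW.sub tendsto_const_nhds).mul tendsto_const_nhds).mul ((tendsto_const_nhds.sub hy).pow 2))

/-- **Joint continuity from Lipschitz bounds plus pointwise convergence**: if maps `F_k` share a
Lipschitz-type bound `‖F_k(u) - F_k(u')‖ ≤ B(u,u')` with `B(u_k, u) → 0` as `u_k → u`, and
`F_k(u) → F(u)` at the fixed point `u`, then `F_k(u_k) → F(u)` (the use made of "the continuity of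
the RG map at `m² = 0`", Theorem 6.3.1). [folklore] -/
theorem tendsto_of_lip_of_pointwise {E : Type*} [NormedAddCommGroup E] {l : Filter ℕ}
    {F : ℕ → E} {G : ℕ → E} {g : E} {B : ℕ → ℝ}
    (hlip : ∀ᶠ k in l, ‖F k - G k‖ ≤ B k) (hB : Tendsto B l (𝓝 0)) (hG : Tendsto G l (𝓝 g)) :
    Tendsto F l (𝓝 g) := by
  have h1 : Tendsto (fun k => F k - G k) l (𝓝 0) := squeeze_zero_norm' hlip hB
  have := h1.add hG
  simpa using this

/-- **Slade, Corollary 7.2.5 (inputs explicit, sequential form).** Along a sequence of data `d n`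
(the masses `m'_n ↓ 0`) satisfying the hypotheses of Theorem 7.2.2 with common constants, with
truncation weights eventually `1` at every scale, converging pointwise to zero-mass data `d₀`
(all of whose weights are `1`), the scale-`0` `μ`-components of the fixed points `x^c(d n) ∈ B₁`
converge to that of the (unique) fixed point of the zero-mass `T` in `B₁`:
"`lim_{m²↓0} μ₀(m²)` exists and equals `μ₀(0)`". [cite: Slade2017, Corollary 7.2.5] -/
theorem Slade2017_cor725
    (h : ∀ n, Hyp c (d n) y₀ K₀) (h₀ : Hyp c d₀ y₀ K₀) (hw₀ : ∀ j, d₀.w j = 1)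
    (hw : ∀ j, ∀ᶠ n in atTop, (d n).w j = 1)
    (hβ : ∀ j, Tendsto (fun n => (d n).β j) atTop (𝓝 (d₀.β j)))
    (hβW : ∀ j, Tendsto (fun n => (d n).βW j) atTop (𝓝 (d₀.βW j)))
    (hξ : ∀ j, Tendsto (fun n => (d n).ξ j) atTop (𝓝 (d₀.ξ j)))
    (hrμ : ∀ j m y (K : W j), InDom c m y K →
      Tendsto (fun n => (d n).rμ j m y K) atTop (𝓝 (d₀.rμ j m y K)))
    (hry : ∀ j m y (K : W j), InDom c m y K →
      Tendsto (fun n => (d n).ry j m y K) atTop (𝓝 (d₀.ry j m y K)))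
    (hKc : ∀ j m y (K : W j), InDom c m y K →
      Tendsto (fun n => (d n).Kc j m y K) atTop (𝓝 (d₀.Kc j m y K)))
    {xs : ℕ → Seq W} (hxs1 : ∀ n j, ‖xs n j‖ ≤ 1) (hxs : ∀ n, xs n = Trow c (d n) y₀ K₀ (xs n))
    {x0 : Seq W}
    (huniq : ∀ y : Seq W, (∀ j, ‖y j‖ ≤ 1) → y = Trow c d₀ y₀ K₀ y → y = x0) :
    Tendsto (fun n => μv c (xs n) 0) atTop (𝓝 (μv c x0 0)) := by
  -- physical coordinates along the sequence
  set M : ℕ → ℕ → ℝ := fun n j => μv c (xs n) j with hM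
  set Y : ℕ → ℕ → ℝ := fun n j => yv c y₀ (xs n) j with hY
  have hdom : ∀ n j, |M n j| ≤ c.wμ ∧ |Y n j| ≤ c.wy j ∧ ‖Kv c K₀ (xs n) j‖ ≤ c.wK :=
    fun n j => (flow_of_fixedPoint (h n) (hxs1 n) (hxs n)).1 j
  -- the core: along any subsequence on which `μ₀` converges, the limit is `μ₀(0)`
  have core : ∀ (φ : ℕ → ℕ) (μs : ℝ), Tendsto φ atTop atTop →
      Tendsto (fun k => M (φ k) 0) atTop (𝓝 μs) → μs = μv c x0 0 := by
    intro φ μs hφ hμs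
    set t := fwd c d₀ y₀ K₀ μs with ht
    -- induction on scales: `x'_j → x*_j`
    have conv : ∀ j, Tendsto (fun k => M (φ k) j) atTop (𝓝 (t j).1) ∧
        Tendsto (fun k => Y (φ k) j) atTop (𝓝 (t j).2.1) ∧
        Tendsto (fun k => Kv c K₀ (xs (φ k)) j) atTop (𝓝 (t j).2.2) := by
      intro j
      induction j with
      | zero =>
        refine ⟨hμs, ?_, ?_⟩
        · simp only [hY, yv_zero]; exact tendsto_const_nhds
        · simp only [Kv_zero]; exact tendsto_const_nhds
      | succ j ih =>
        obtain ⟨ihM, ihY, ihK⟩ := ih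
        -- the limit point lies in the (closed) domain
        have hm0 : |(t j).1| ≤ c.wμ :=
          le_of_tendsto' ((continuous_abs.tendsto _).comp ihM) fun k => (hdom _ j).1
        have hy0 : |(t j).2.1| ≤ c.sbar / 32 :=
          le_of_tendsto' ((continuous_abs.tendsto _).comp ihY)
            fun k => ((hdom _ j).2.1.trans (h₀.wy_le j))
        have hK0 : ‖(t j).2.2‖ ≤ c.wK := le_of_tendsto' ihK.norm fun k => (hdom _ j).2.2
        have hin0 : InDom c (t j).1 (t j).2.1 (t j).2.2 := ⟨hm0, hy0, hK0⟩
        have hin : ∀ k, InDom c (M (φ k) j) (Y (φ k) j) (Kv c K₀ (xs (φ k)) j) :=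
          fun k => (h (φ k)).inDom (hxs1 (φ k) j)
        -- differences of the arguments tend to zero
        have dM : Tendsto (fun k => |M (φ k) j - (t j).1|) atTop (𝓝 0) := by
          have := tendsto_iff_norm_sub_tendsto_zero.1 ihM
          simpa only [Real.norm_eq_abs] using this
        have dY : Tendsto (fun k => |Y (φ k) j - (t j).2.1|) atTop (𝓝 0) := by
          have := tendsto_iff_norm_sub_tendsto_zero.1 ihY
          simpa only [Real.norm_eq_abs] using this
        have dK : Tendsto (fun k => ‖Kv c K₀ (xs (φ k)) j - (t j).2.2‖) atTop (𝓝 0) :=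
          tendsto_iff_norm_sub_tendsto_zero.1 ihK
        have dB : Tendsto (fun k => c.C₂ * c.sbar ^ 2 * (|M (φ k) j - (t j).1|
            + |Y (φ k) j - (t j).2.1|) + c.C₀ * ‖Kv c K₀ (xs (φ k)) j - (t j).2.2‖)
            atTop (𝓝 0) := by
          have := ((dM.add dY).const_mul (c.C₂ * c.sbar ^ 2)).add (dK.const_mul c.C₀)
          simpa using this
        have dB' : Tendsto (fun k => c.CK * c.sbar ^ 2 * (|M (φ k) j - (t j).1|
            + |Y (φ k) j - (t j).2.1|) + c.κ * ‖Kv c K₀ (xs (φ k)) j - (t j).2.2‖)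
            atTop (𝓝 0) := by
          have := ((dM.add dY).const_mul (c.CK * c.sbar ^ 2)).add (dK.const_mul c.κ)
          simpa using this
        -- convergence of the three remainder/RG-map terms (joint continuity)
        have tr : Tendsto (fun k => (d (φ k)).rμ j (M (φ k) j) (Y (φ k) j) (Kv c K₀ (xs (φ k)) j))
            atTop (𝓝 (d₀.rμ j (t j).1 (t j).2.1 (t j).2.2)) := by
          refine tendsto_of_lip_of_pointwise (Eventually.of_forall fun k => ?_) dB
            ((hrμ j _ _ _ hin0).comp hφ)
          rw [Real.norm_eq_abs]
          exact (h (φ k)).rμ_lip j _ _ _ _ _ _ (hin k) hin0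
        have tr' : Tendsto (fun k => (d (φ k)).ry j (M (φ k) j) (Y (φ k) j) (Kv c K₀ (xs (φ k)) j))
            atTop (𝓝 (d₀.ry j (t j).1 (t j).2.1 (t j).2.2)) := by
          refine tendsto_of_lip_of_pointwise (Eventually.of_forall fun k => ?_) dB
            ((hry j _ _ _ hin0).comp hφ)
          rw [Real.norm_eq_abs]
          exact (h (φ k)).ry_lip j _ _ _ _ _ _ (hin k) hin0
        have tK : Tendsto (fun k => (d (φ k)).Kc j (M (φ k) j) (Y (φ k) j) (Kv c K₀ (xs (φ k)) j))
            atTop (𝓝 (d₀.Kc j (t j).1 (t j).2.1 (t j).2.2)) :=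
          tendsto_of_lip_of_pointwise (Eventually.of_forall fun k =>
            (h (φ k)).Kc_lip j _ _ _ _ _ _ (hin k) hin0) dB' ((hKc j _ _ _ hin0).comp hφ)
        have tρ := tendsto_ρμ (c := c) ((hβ j).comp hφ) ((hξ j).comp hφ) ihM ihY
        have tY := tendsto_Ymap (c := c) ((hβW j).comp hφ) ihY
        -- the flow equations hold eventually along the subsequence
        have hev : ∀ᶠ k in atTop, (d (φ k)).w j = 1 ∧ (d (φ k)).w (j + 1) = 1 :=
          hφ.eventually ((hw j).and (hw (j + 1)))
        refine ⟨?_, ?_, ?_⟩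
        · have lim : Tendsto (fun k => c.Lα * M (φ k) j
              + ρμ c (d (φ k)) j (M (φ k) j) (Y (φ k) j)
              + (d (φ k)).rμ j (M (φ k) j) (Y (φ k) j) (Kv c K₀ (xs (φ k)) j)) atTop
              (𝓝 (t (j + 1)).1) := by
            have e : (t (j + 1)).1 = c.Lα * (t j).1 + ρμ c d₀ j (t j).1 (t j).2.1
                + d₀.rμ j (t j).1 (t j).2.1 (t j).2.2 := by rw [ht]; rfl
            rw [e]
            exact ((tendsto_const_nhds.mul ihM).add tρ).add tr
          refine lim.congr' (hev.mono fun k hk => ?_)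
          exact ((flow_of_fixedPoint (h (φ k)) (hxs1 (φ k)) (hxs (φ k))).2.1 j hk.1).symm
        · have lim : Tendsto (fun k => Ymap c (d (φ k)) j (Y (φ k) j)
              + (d (φ k)).ry j (M (φ k) j) (Y (φ k) j) (Kv c K₀ (xs (φ k)) j)) atTop
              (𝓝 (t (j + 1)).2.1) := by
            have e : (t (j + 1)).2.1 = Ymap c d₀ j (t j).2.1
                + d₀.ry j (t j).1 (t j).2.1 (t j).2.2 := by rw [ht]; rfl
            rw [e]
            exact tY.add tr'
          refine lim.congr' (hev.mono fun k hk => ?_)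
          exact ((flow_of_fixedPoint (h (φ k)) (hxs1 (φ k)) (hxs (φ k))).2.2.1 j hk.2).symm
        · have e : (t (j + 1)).2.2 = d₀.Kc j (t j).1 (t j).2.1 (t j).2.2 := by rw [ht]; rfl
          rw [e]
          refine tK.congr' (hev.mono fun k hk => ?_)
          exact ((flow_of_fixedPoint (h (φ k)) (hxs1 (φ k)) (hxs (φ k))).2.2.2.1 j hk.2).symm
    -- the limits stay in the domain; the rescaled `x*` lies in `B₁`
    have hdom0 : ∀ j, |(t j).1| ≤ c.wμ ∧ |(t j).2.1| ≤ c.wy j ∧ ‖(t j).2.2‖ ≤ c.wK := by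
      intro j
      obtain ⟨cM, cY, cK⟩ := conv j
      exact ⟨le_of_tendsto' ((continuous_abs.tendsto _).comp cM) fun k => (hdom _ j).1,
        le_of_tendsto' ((continuous_abs.tendsto _).comp cY) fun k => (hdom _ j).2.1,
        le_of_tendsto' cK.norm fun k => (hdom _ j).2.2⟩
    have hB1 : ∀ j, ‖rescale c t j‖ ≤ 1 := by
      intro j
      have hwμ := h₀.wμ_pos; have hwK := h₀.wK_pos
      rcases j with _ | j
      · refine norm_triple_le ?_ (by simp [rescale]) (by simp [rescale])
        simp only [rescale]
        rw [abs_div, abs_of_pos hwμ, div_le_one hwμ]; exact (hdom0 0).1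
      · have hwy := h₀.wy_pos (j + 1)
        refine norm_triple_le ?_ ?_ ?_ <;> simp only [rescale]
        · rw [abs_div, abs_of_pos hwμ, div_le_one hwμ]; exact (hdom0 _).1
        · rw [abs_div, abs_of_pos hwy, div_le_one hwy]; exact (hdom0 _).2.1
        · rw [norm_smul, norm_inv, Real.norm_eq_abs, abs_of_pos hwK,
            inv_mul_le_iff₀ hwK, mul_one]
          exact (hdom0 _).2.2
    -- `x*` is a fixed point of the zero-mass `T`, hence equals `x0`
    have hfix : rescale c t = Trow c d₀ y₀ K₀ (rescale c t) :=
      fwd_fixedPoint h₀.wμ_pos.ne' (fun j => (h₀.wy_pos j).ne') h₀.wK_pos.ne' h₀.Lα_pos.ne' hw₀ μs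
    have heq : rescale c t = x0 := huniq _ hB1 hfix
    have h1 : μv c (rescale c t) 0 = (t 0).1 := μv_rescale h₀.wμ_pos.ne' _ 0
    rw [← heq, h1, ht]; rfl
  -- every subsequence has a sub-subsequence along which `μ₀` converges (compactness), and by
  -- `core` the limit is always `μ₀(0)`
  refine tendsto_of_subseq_tendsto fun ns hns => ?_
  have hbd : ∀ n, M (ns n) 0 ∈ Icc (-c.wμ) c.wμ := fun n => abs_le.1 (hdom _ 0).1
  obtain ⟨μs, -, ms, hms, hlim⟩ := isCompact_Icc.tendsto_subseq hbd
  refine ⟨ms, ?_⟩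
  have hφ : Tendsto (ns ∘ ms) atTop atTop := hns.comp hms.tendsto_atTop
  have hlim' : Tendsto (fun k => M ((ns ∘ ms) k) 0) atTop (𝓝 μs) := hlim
  rw [core (ns ∘ ms) μs hφ hlim'] at hlim'
  exact hlim'

/-- **Corollary 7.2.5 with the fixed points supplied by Theorem 7.2.2** (`exists_fixedPoint`):
the `μ₀` of the fixed points `x^c(d n)` converge to the `μ₀` of the zero-mass fixed point.
[cite: Slade2017, Corollary 7.2.5] -/
theorem Slade2017_cor725' [∀ j, CompleteSpace (W j)]
    (h : ∀ n, Hyp c (d n) y₀ K₀) (h₀ : Hyp c d₀ y₀ K₀) (hw₀ : ∀ j, d₀.w j = 1)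
    (hw : ∀ j, ∀ᶠ n in atTop, (d n).w j = 1)
    (hβ : ∀ j, Tendsto (fun n => (d n).β j) atTop (𝓝 (d₀.β j)))
    (hβW : ∀ j, Tendsto (fun n => (d n).βW j) atTop (𝓝 (d₀.βW j)))
    (hξ : ∀ j, Tendsto (fun n => (d n).ξ j) atTop (𝓝 (d₀.ξ j)))
    (hrμ : ∀ j m y (K : W j), InDom c m y K →
      Tendsto (fun n => (d n).rμ j m y K) atTop (𝓝 (d₀.rμ j m y K)))
    (hry : ∀ j m y (K : W j), InDom c m y K →
      Tendsto (fun n => (d n).ry j m y K) atTop (𝓝 (d₀.ry j m y K)))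
    (hKc : ∀ j m y (K : W j), InDom c m y K →
      Tendsto (fun n => (d n).Kc j m y K) atTop (𝓝 (d₀.Kc j m y K)))
    {xs : ℕ → X W} (hxs1 : ∀ n j, ‖xs n j‖ ≤ 1) (hxs : ∀ n, ⇑(xs n) = Trow c (d n) y₀ K₀ (xs n))
    {x0 : X W} (hx0 : ∀ y : X W, (∀ j, ‖y j‖ ≤ 1) → ⇑y = Trow c d₀ y₀ K₀ y → y = x0) :
    Tendsto (fun n => μv c (xs n) 0) atTop (𝓝 (μv c x0 0)) := by
  refine Slade2017_cor725 h h₀ hw₀ hw hβ hβW hξ hrμ hry hKc (xs := fun n => ⇑(xs n)) hxs1 hxs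
    (x0 := ⇑x0) fun y hy hfy => ?_
  -- a bounded raw fixed point is an element of `X`; uniqueness there
  have hmem : Memℓp y ∞ := FlowSpace.memℓp_infty_of_forall_le hy
  have := hx0 ⟨y, hmem⟩ hy hfy
  rw [← this]

end Cor725

end CriticalFlow

end LongRangePhi4

end Literature.Barriers.CriticalPhenomena
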